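import Summits.CriticalPhenomena.Ising3D.Control2DVertexExpansions
import Mathlib.Tactic
import HarnessLib

/-!
# The free-boson vertex-operator witness, V: the two sectors of `𝒢 - 1` as double block expansions
(cell `pub-ising3x`, seat controls-1 gen 36; NON-VACUITY of the 2D control's hypothesis classes WITH a
stress tensor, step 5 of 7 — CONTROL-ONLY)

HONEST FRAMING: lottery ticket; floor = tightest certified 3D Ising CFT bounds; no exact-solution
claim without a proof. CONTROL-ONLY (`d = 2`); nothing numerical is asserted here.

The free-boson vertex four-point function (`O = √2 cos(αφ)`, `Δ_O = s = α²`, `c = 1`;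
Di Francesco–Mathieu–Sénéchal §9.1) is `𝒢 = ½(v^{-s} + v^{s} + u^{2s} v^{-s})`, `u = z z̄`, `v = (1-z)(1-z̄)`.
On the open square `z, z̄ ∈ (0,1)` this file expands its two sectors in products of chiral blocks:

* `foldPairs`, `hasSum_foldPairs` — folding a non-negative summable family on `ℕ × ℕ` onto ordered pairs
  `n ≥ m` (`(n,m) ↦ F(n,m) + F(m,n)`, the diagonal once) preserves the sum: this is how each quasi-primary
  location `{h, h̄}` becomes ONE label of the datum in `Control2DVertexData`;
* `vtxAlpha' s n` (`α'_0 = 1`, `α'_n = α_n(s)`), `hasSum_vtxAlpha'`, `hasSum_vtxAlpha'_signed`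
  (`Σ α'_n k_{2n} = (1-x)^{-s}`, `Σ (-1)^n α'_n k_{2n} = (1-x)^{s}`), and the identity-sector double family
  `vtxIdDouble` with `hasSum_vtxIdDouble` — **`Σ_{(n,m) ≠ (0,0), n+m even} α'_n α'_m k_{2n}(z) k_{2m}(z̄) = ½(v^{-s} + v^{s}) - 1`**;
* the charge-two double family `vtxChDouble` with `hasSum_vtxChDouble` —
  **`Σ_{k,l} ½ γ_k γ_l k_{4s+4k}(z) k_{4s+4l}(z̄) = ½ u^{2s} v^{-s}`** (as `½ (z^{2s}/(1-z)^s)(z̄^{2s}/(1-z̄)^s)`).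

References: Ph. Di Francesco, P. Mathieu, D. Sénéchal, Conformal Field Theory (Springer 1997), §9.1
[cite: DiFrancescoMathieuSenechal1997, §9.1]; F. A. Dolan, H. Osborn, Nucl. Phys. B 678 (2004) 491, §3
[cite: DolanOsborn2004, §3]. Mathlib: `Summable.of_nonneg_of_le`, `Equiv.hasSum_iff`, `HasSum.mul`,
`Summable.of_norm_bounded`, `hasSum_ite_eq`. Tree: `hasSum_vtx_rpow`, `hasSum_vtx_rpow_pos`, `hasSum_vtx_charge`,
`vtxAlpha`, `vtxGamma` (`Control2DVertexExpansions`), `chiralBlock_nonneg` (`Control2DNonVacuity`).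
-/

namespace Summit.CriticalPhenomena.Ising3D.Control2D

open Finset Set
open Literature.MathematicalPhysics.QuantumFieldTheory.ConformalBootstrap3D

section Sectors

variable {s z zb : ℝ}

/-! ### Symmetrising an absolutely convergent double family onto ordered pairs `n ≥ m` -/

/-- Folding a family on `ℕ × ℕ` onto the pairs `n ≥ m`: `(n,m) ↦ F(n,m) + F(m,n)` for `n > m`,
`F(n,n)` on the diagonal, `0` below. [folklore] -/
noncomputable def foldPairs (F : ℕ × ℕ → ℝ) (nm : ℕ × ℕ) : ℝ :=
  if nm.2 < nm.1 then F nm + F nm.swap else if nm.2 = nm.1 then F nm else 0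

/-- The part of `F` on or below the diagonal `m ≤ n`. [folklore] -/
noncomputable def upperPart (F : ℕ × ℕ → ℝ) (nm : ℕ × ℕ) : ℝ := if nm.2 ≤ nm.1 then F nm else 0

/-- The part of `F` strictly above the diagonal `n < m`. [folklore] -/
noncomputable def lowerPart (F : ℕ × ℕ → ℝ) (nm : ℕ × ℕ) : ℝ := if nm.1 < nm.2 then F nm else 0

/-- `F = upper + lower`. [folklore] -/
theorem upperPart_add_lowerPart (F : ℕ × ℕ → ℝ) (nm : ℕ × ℕ) :
    upperPart F nm + lowerPart F nm = F nm := by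
  unfold upperPart lowerPart
  by_cases h : nm.2 ≤ nm.1
  · rw [if_pos h, if_neg (not_lt.mpr h), add_zero]
  · rw [if_neg h, if_pos (not_le.mp h), zero_add]

/-- `fold F = upper F + (lower F) ∘ swap`. [folklore] -/
theorem foldPairs_eq (F : ℕ × ℕ → ℝ) (nm : ℕ × ℕ) :
    foldPairs F nm = upperPart F nm + lowerPart F nm.swap := by
  obtain ⟨n, m⟩ := nm
  simp only [foldPairs, upperPart, lowerPart, Prod.swap_prod_mk]
  by_cases h1 : m < n
  · rw [if_pos h1, if_pos h1.le, if_pos h1]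
  · by_cases h2 : m = n
    · subst h2
      rw [if_neg h1, if_pos rfl, if_pos le_rfl, if_neg (lt_irrefl m), add_zero]
    · rw [if_neg h1, if_neg h2, if_neg (by omega), if_neg (by omega), add_zero]

/-- Bounds `0 ≤ upper F ≤ F`, `0 ≤ lower F ≤ F` for `F ≥ 0`. [folklore] -/
theorem upperPart_lowerPart_bounds {F : ℕ × ℕ → ℝ} (hF0 : ∀ p, 0 ≤ F p) (nm : ℕ × ℕ) :
    (0 ≤ upperPart F nm ∧ upperPart F nm ≤ F nm) ∧ (0 ≤ lowerPart F nm ∧ lowerPart F nm ≤ F nm) := by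
  unfold upperPart lowerPart
  constructor <;> split_ifs <;> simp [hF0 nm]

/-- **Folding preserves the sum** of a non-negative summable family. [folklore] -/
theorem hasSum_foldPairs {F : ℕ × ℕ → ℝ} {S : ℝ} (hF0 : ∀ p, 0 ≤ F p) (hF : HasSum F S) :
    HasSum (foldPairs F) S := by
  have hb := upperPart_lowerPart_bounds hF0
  have hUs : Summable (upperPart F) :=
    Summable.of_nonneg_of_le (fun p => (hb p).1.1) (fun p => (hb p).1.2) hF.summable
  have hLs : Summable (lowerPart F) :=
    Summable.of_nonneg_of_le (fun p => (hb p).2.1) (fun p => (hb p).2.2) hF.summable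
  have hsum : HasSum (fun p => upperPart F p + lowerPart F p) S :=
    hF.congr_fun fun p => upperPart_add_lowerPart F p
  have hUL : ∑' p, upperPart F p + ∑' p, lowerPart F p = S := (hUs.hasSum.add hLs.hasSum).unique hsum
  have hL' := (Equiv.prodComm ℕ ℕ).hasSum_iff.mpr hLs.hasSum
  have key := hUs.hasSum.add hL'
  rw [hUL] at key
  refine key.congr_fun fun p => ?_
  rw [foldPairs_eq]
  simp only [Function.comp_apply, Equiv.prodComm_apply]

/-! ### The identity (`U(1)`-current) sector: `½(v^{-s} + v^{s}) - 1` -/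

/-- `α'_n`: `1` for `n = 0` (the identity block), `α_n(s)` for `n ≥ 1`. [folklore] -/
noncomputable def vtxAlpha' (s : ℝ) (n : ℕ) : ℝ := if n = 0 then 1 else vtxAlpha s n

/-- `α'_n ≥ 0` for `s ≥ 0`. [folklore] -/
theorem vtxAlpha'_nonneg (hs : 0 ≤ s) (n : ℕ) : 0 ≤ vtxAlpha' s n := by
  unfold vtxAlpha'; split_ifs
  · exact zero_le_one
  · exact vtxAlpha_nonneg hs n

/-- `Σ_n α'_n k_{2n}(x) = (1-x)^{-s}` (identity block included). [folklore] -/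
theorem hasSum_vtxAlpha' (s : ℝ) {x : ℝ} (hx : x ∈ Ioo (0 : ℝ) 1) :
    HasSum (fun n : ℕ => vtxAlpha' s n * chiralBlock n x) ((1 - x) ^ (-s)) := by
  have h := (hasSum_vtx_rpow s hx).add (hasSum_ite_eq 0 (1 : ℝ))
  rw [sub_add_cancel] at h
  refine h.congr_fun fun n => ?_
  unfold vtxAlpha'
  split_ifs with hn
  · subst hn; simp [(vtxAlpha_values s).1, chiralBlock_zero]
  · simp

/-- `Σ_n (-1)^n α'_n k_{2n}(x) = (1-x)^{s}`. [folklore] -/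
theorem hasSum_vtxAlpha'_signed (s : ℝ) {x : ℝ} (hx : x ∈ Ioo (0 : ℝ) 1) :
    HasSum (fun n : ℕ => (-1 : ℝ) ^ n * (vtxAlpha' s n * chiralBlock n x)) ((1 - x) ^ s) := by
  have h := (hasSum_vtx_rpow_pos s hx).add (hasSum_ite_eq 0 (1 : ℝ))
  rw [sub_add_cancel] at h
  refine h.congr_fun fun n => ?_
  unfold vtxAlpha'
  split_ifs with hn
  · subst hn; simp [(vtxAlpha_values s).1, chiralBlock_zero]
  · simp

/-- The identity-sector double family `A(n,m) = [n+m even] [(n,m) ≠ (0,0)] α'_n α'_m k_{2n}(z) k_{2m}(z̄)`.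
[folklore] -/
noncomputable def vtxIdDouble (s z zb : ℝ) (nm : ℕ × ℕ) : ℝ :=
  if Even (nm.1 + nm.2) ∧ nm ≠ (0, 0) then
    vtxAlpha' s nm.1 * vtxAlpha' s nm.2 * (chiralBlock nm.1 z * chiralBlock nm.2 zb) else 0

/-- `A ≥ 0` (`s ≥ 0`). [folklore] -/
theorem vtxIdDouble_nonneg (hs : 0 ≤ s) (hz : z ∈ Ioo (0 : ℝ) 1) (hzb : zb ∈ Ioo (0 : ℝ) 1)
    (nm : ℕ × ℕ) : 0 ≤ vtxIdDouble s z zb nm := by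
  unfold vtxIdDouble
  split_ifs
  · have h1 := vtxAlpha'_nonneg hs nm.1
    have h2 := vtxAlpha'_nonneg hs nm.2
    have h3 := chiralBlock_nonneg (Nat.cast_nonneg nm.1) hz
    have h4 := chiralBlock_nonneg (Nat.cast_nonneg nm.2) hzb
    positivity
  · exact le_rfl

/-- **`Σ A = ½(v^{-s} + v^{s}) - 1`** on the open square. [cite: DiFrancescoMathieuSenechal1997, §9.1] -/
theorem hasSum_vtxIdDouble (hs : 0 ≤ s) (hz : z ∈ Ioo (0 : ℝ) 1) (hzb : zb ∈ Ioo (0 : ℝ) 1) :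
    HasSum (vtxIdDouble s z zb)
      (((1 - z) ^ (-s) * (1 - zb) ^ (-s) + (1 - z) ^ s * (1 - zb) ^ s) / 2 - 1) := by
  obtain ⟨f, hf_def⟩ : ∃ f : ℕ → ℝ, f = fun n => vtxAlpha' s n * chiralBlock n z := ⟨_, rfl⟩
  obtain ⟨g, hg_def⟩ : ∃ g : ℕ → ℝ, g = fun m => vtxAlpha' s m * chiralBlock m zb := ⟨_, rfl⟩
  have hf : HasSum f ((1 - z) ^ (-s)) := hf_def ▸ hasSum_vtxAlpha' s hz
  have hg : HasSum g ((1 - zb) ^ (-s)) := hg_def ▸ hasSum_vtxAlpha' s hzb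
  have hf0 : 0 ≤ f := fun n => by
    rw [hf_def]; exact mul_nonneg (vtxAlpha'_nonneg hs n) (chiralBlock_nonneg (Nat.cast_nonneg n) hz)
  have hg0 : 0 ≤ g := fun m => by
    rw [hg_def]; exact mul_nonneg (vtxAlpha'_nonneg hs m) (chiralBlock_nonneg (Nat.cast_nonneg m) hzb)
  have hP : Summable fun nm : ℕ × ℕ => f nm.1 * g nm.2 := hf.summable.mul_of_nonneg hg.summable hf0 hg0
  have P1 : HasSum (fun nm : ℕ × ℕ => f nm.1 * g nm.2) ((1 - z) ^ (-s) * (1 - zb) ^ (-s)) := hf.mul hg hP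
  have hf' : HasSum (fun n => (-1 : ℝ) ^ n * f n) ((1 - z) ^ s) := hf_def ▸ hasSum_vtxAlpha'_signed s hz
  have hg' : HasSum (fun m => (-1 : ℝ) ^ m * g m) ((1 - zb) ^ s) := hg_def ▸ hasSum_vtxAlpha'_signed s hzb
  have hP' : Summable fun nm : ℕ × ℕ => ((-1 : ℝ) ^ nm.1 * f nm.1) * ((-1 : ℝ) ^ nm.2 * g nm.2) := by
    refine Summable.of_norm_bounded hP fun nm => le_of_eq ?_
    simp only [norm_mul, norm_pow, norm_neg, norm_one, one_pow, one_mul,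
      Real.norm_of_nonneg (hf0 nm.1), Real.norm_of_nonneg (hg0 nm.2)]
  have P2 : HasSum (fun nm : ℕ × ℕ => ((-1 : ℝ) ^ nm.1 * f nm.1) * ((-1 : ℝ) ^ nm.2 * g nm.2))
      ((1 - z) ^ s * (1 - zb) ^ s) := hf'.mul hg' hP'
  have T := ((P1.add P2).div_const 2).sub (hasSum_ite_eq ((0, 0) : ℕ × ℕ) (1 : ℝ))
  refine T.congr_fun fun nm => ?_
  obtain ⟨n, m⟩ := nm
  simp only [hf_def, hg_def, vtxIdDouble]
  by_cases he : Even (n + m)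
  · have hε : (-1 : ℝ) ^ n * (-1 : ℝ) ^ m = 1 := by rw [← pow_add, he.neg_one_pow]
    by_cases h0 : ((n, m) : ℕ × ℕ) = (0, 0)
    · simp only [Prod.mk.injEq] at h0
      obtain ⟨rfl, rfl⟩ := h0
      simp [vtxAlpha', chiralBlock_zero]
    · rw [if_pos ⟨he, h0⟩, if_neg h0]
      linear_combination (-(vtxAlpha' s n * chiralBlock (n : ℝ) z * (vtxAlpha' s m * chiralBlock (m : ℝ) zb)) / 2) * hε
  · have ho : Odd (n + m) := Nat.not_even_iff_odd.mp he
    have hε : (-1 : ℝ) ^ n * (-1 : ℝ) ^ m = -1 := by rw [← pow_add, ho.neg_one_pow]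
    have h0 : ¬ ((n, m) : ℕ × ℕ) = (0, 0) := by
      intro h; simp only [Prod.mk.injEq] at h; obtain ⟨rfl, rfl⟩ := h; exact he (by simp)
    rw [if_neg (fun h => he h.1), if_neg h0]
    linear_combination (-(vtxAlpha' s n * chiralBlock (n : ℝ) z * (vtxAlpha' s m * chiralBlock (m : ℝ) zb)) / 2) * hε

/-! ### The charge-two sector: `½ u^{2s} v^{-s}` -/

/-- The charge-sector double family `C(k,l) = ½ γ_k γ_l k_{4s+4k}(z) k_{4s+4l}(z̄)`. [folklore] -/
noncomputable def vtxChDouble (s z zb : ℝ) (kl : ℕ × ℕ) : ℝ :=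
  vtxGamma kl.1 s * vtxGamma kl.2 s * (chiralBlock (2 * s + 2 * kl.1) z * chiralBlock (2 * s + 2 * kl.2) zb) / 2

/-- `C ≥ 0` (`s > 0`). [folklore] -/
theorem vtxChDouble_nonneg (hs : 0 < s) (hz : z ∈ Ioo (0 : ℝ) 1) (hzb : zb ∈ Ioo (0 : ℝ) 1)
    (kl : ℕ × ℕ) : 0 ≤ vtxChDouble s z zb kl := by
  unfold vtxChDouble
  have h1 := (vtxGamma_pos kl.1 hs).le
  have h2 := (vtxGamma_pos kl.2 hs).le
  have h3 := chiralBlock_nonneg (show (0 : ℝ) ≤ 2 * s + 2 * kl.1 by positivity) hz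
  have h4 := chiralBlock_nonneg (show (0 : ℝ) ≤ 2 * s + 2 * kl.2 by positivity) hzb
  positivity

/-- **`Σ C = ½ (z^{2s}/(1-z)^s)(z̄^{2s}/(1-z̄)^s) = ½ u^{2s} v^{-s}`**. [cite: DiFrancescoMathieuSenechal1997, §9.1] -/
theorem hasSum_vtxChDouble (hs : 0 < s) (hz : z ∈ Ioo (0 : ℝ) 1) (hzb : zb ∈ Ioo (0 : ℝ) 1) :
    HasSum (vtxChDouble s z zb) ((z ^ (2 * s) / (1 - z) ^ s) * (zb ^ (2 * s) / (1 - zb) ^ s) / 2) := by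
  have hf := hasSum_vtx_charge hs hz
  have hg := hasSum_vtx_charge hs hzb
  have hf0 : ∀ k, 0 ≤ vtxGamma k s * chiralBlock (2 * s + 2 * k) z := fun k =>
    mul_nonneg (vtxGamma_pos k hs).le (chiralBlock_nonneg (by positivity) hz)
  have hg0 : ∀ l, 0 ≤ vtxGamma l s * chiralBlock (2 * s + 2 * l) zb := fun l =>
    mul_nonneg (vtxGamma_pos l hs).le (chiralBlock_nonneg (by positivity) hzb)
  have P := (hf.mul hg (hf.summable.mul_of_nonneg hg.summable hf0 hg0)).div_const 2
  refine P.congr_fun fun kl => ?_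
  simp only [vtxChDouble]
  ring

end Sectors

end Summit.CriticalPhenomena.Ising3D.Control2D
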